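import Summits.Schanuel.Schanuel.Theorems.RootDecomp1KHyper23

/-!
# RootDecomp1KHyper — lens 6, generation 15 «QUAD-ANCHORED CELL» (QuadAnchor.lean 33b3769e…, 2400 l) — continuation (RootDecomp1KHyper24): §5 the family `quadTriple D y = (1, √D, y)`: anchor, hyper-Liouville forms, ℚ-freeness, `sb_three_quadTriple`

(lens-6 g15 `QuadAnchor.lean`, sha256 33b3769e…6b415, farm rc 0 · 0 sorry · axioms standard; port by census-1 gen 14 in eight parts RootDecomp1KHyper20–27 at the section
cuts of CENSUS-REQUEST 2026-08-31T01:16:56Z (STATUS L1528; §5 cut at §5b; §3's three engine corollaries moved to where they are first used); each part imports the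
previous; statements and proofs verbatim (54 one-line docstrings added, six generic one-liners privatised with per-part private copies, the two `linter.*` options dropped, two unused binders renamed `_`); `hLW : LWMeasure` (tree-proved
named fact) stays a binder where marked; `--supports stmt-Schanuel-33363` (A₄ʰ HyperLiouvilleSchanuel, residual of record `Rank3SpanResidual`). Nothing here proves Schanuel; rung 0.)
-/

noncomputable section

open Complex IntermediateField Polynomial

namespace Summit.Schanuel.Schanuel.Theorems.RootDecomp1KHyper

namespace HyperCell
variable {n : ℕ}
open Summit.Schanuel.Schanuel.Theorems.RootDecomp1KGeneric (HasHLPairInSpan Rank3SpanResidual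
  mem_adjoin_of_mem_span cexp_mem_adjoin_of_mem_span)

/-- `exp(−x) ≤ 1/x` for `x > 0`. -/
private theorem exp_neg_le_one_div' {x : ℝ} (hx : 0 < x) : Real.exp (-x) ≤ 1 / x := by
  rw [Real.exp_neg, ← one_div]
  exact one_div_le_one_div_of_le hx (by linarith [Real.add_one_le_exp x])

set_option maxHeartbeats 1000000 in

/-- `(q : ℝ) · den q = num q`. -/
private theorem ratCast_mul_den (q : ℚ) : (q : ℝ) * q.den = q.num := by
  exact_mod_cast Rat.mul_den_eq_num q

/-! ## 5. The cell as a one-parameter family: the triples `(1, √D, y)`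

Up to `GL₃(ℤ)`-re-basing and a rational rescaling, an anchored triple is `(1, √D, y)`; for these the
three hypotheses of the MAIN THEOREM collapse to the single arithmetic condition `HyperQuadApprox D y`
(and conversely `HyperQuadApprox D y` is what §4 extracts).  So the anchored cell is DECIDED as the
explicit family `{(1, √D, y) : √D ∉ ℚ, y hyper-approximable from ℚ(√D)}` (mod the LW measure). -/

/-- The triple `(1, √D, y)`. -/
def quadTriple (D : ℕ) (y : ℝ) : Fin 3 → ℂ := ![(1 : ℂ), ((Real.sqrt D : ℝ) : ℂ), (y : ℂ)]

/-- Coordinate `0` of `quadTriple D y = (1, √D, y)`. -/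
@[simp] theorem quadTriple_zero (D : ℕ) (y : ℝ) : quadTriple D y 0 = 1 := rfl
/-- Coordinate `1` of `quadTriple D y = (1, √D, y)`. -/
@[simp] theorem quadTriple_one (D : ℕ) (y : ℝ) : quadTriple D y 1 = ((Real.sqrt D : ℝ) : ℂ) := rfl
/-- Coordinate `2` of `quadTriple D y = (1, √D, y)`. -/
@[simp] theorem quadTriple_two (D : ℕ) (y : ℝ) : quadTriple D y 2 = (y : ℂ) := rfl

/-- `(1, √D, y)` is anchored (`q₁ = q₂ = 1`). -/
theorem hasRealQuadAnchor_quadTriple {D : ℕ} (hD : Irrational (Real.sqrt D)) (y : ℝ) :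
    HasRealQuadAnchor (quadTriple D y) := by
  have h0 : quadTriple D y 0 ∈ Submodule.span ℤ (Set.range (quadTriple D y)) :=
    Submodule.subset_span (Set.mem_range_self 0)
  have h1 : quadTriple D y 1 ∈ Submodule.span ℤ (Set.range (quadTriple D y)) :=
    Submodule.subset_span (Set.mem_range_self 1)
  refine ⟨D, 1, 1, hD, one_ne_zero, one_ne_zero, ?_, ?_⟩
  · simpa using h0
  · simpa using h1

/-- The form `−a − b√D + q y` evaluated on `(1, √D, y)`. -/
private theorem quadTriple_form (D : ℕ) (y : ℝ) (a b : ℤ) (q : ℕ) :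
    ∑ i, ((![-a, -b, (q : ℤ)] : Fin 3 → ℤ) i : ℂ) * quadTriple D y i =
      (((q : ℝ) * y - (a : ℝ) - (b : ℝ) * Real.sqrt D : ℝ) : ℂ) := by
  rw [Fin.sum_univ_three]
  simp only [quadTriple_zero, quadTriple_one, quadTriple_two, Matrix.cons_val_zero,
    Matrix.cons_val_one, Matrix.head_cons, Matrix.cons_val_two, Matrix.tail_cons]
  push_cast
  ring

/-- The height `Σ i, |h i|` of the coefficient vector `(−a, −b, q)` is `|a| + |b| + q`. -/
private theorem quadTriple_hsum (a b : ℤ) (q : ℕ) :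
    ∑ i, |(((![-a, -b, (q : ℤ)] : Fin 3 → ℤ) i : ℤ) : ℝ)| = |(a : ℝ)| + |(b : ℝ)| + q := by
  rw [Fin.sum_univ_three]
  simp only [Matrix.cons_val_zero, Matrix.cons_val_one, Matrix.head_cons, Matrix.cons_val_two,
    Matrix.tail_cons, Int.cast_neg, abs_neg, Int.cast_natCast, Nat.abs_cast]

/-- `q · exp(−X^(m+1)) ≤ exp(−X^m)` for `0 < q ≤ X`, `1 ≤ X`. -/
private theorem mul_exp_neg_pow_succ_le {q X : ℝ} (hq : 0 < q) (hqX : q ≤ X) (hX : 1 ≤ X) (m : ℕ) :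
    q * Real.exp (-(X ^ (m + 1))) ≤ Real.exp (-(X ^ m)) := by
  have hlog : Real.log q ≤ X ^ (m + 1) - X ^ m :=
    calc Real.log q ≤ q - 1 := Real.log_le_sub_one_of_pos hq
      _ ≤ X - 1 := by linarith
      _ ≤ X ^ m * (X - 1) := le_mul_of_one_le_left (by linarith) (one_le_pow₀ hX)
      _ = X ^ (m + 1) - X ^ m := by ring
  rw [← Real.exp_log hq, ← Real.exp_add]
  exact Real.exp_le_exp.mpr (by linarith)

/-- **`HyperQuadApprox D y` ⇒ `(1, √D, y)` is `HyperLinLiouville`** (the approximants ARE small forms). -/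
theorem hyperLinLiouville_quadTriple {D : ℕ} {y : ℝ} (hy : HyperQuadApprox D y) :
    HyperLinLiouville (quadTriple D y) := by
  intro m
  obtain ⟨a, b, q, hq, hne, hlt⟩ := hy (m + 1)
  refine ⟨![-a, -b, (q : ℤ)], ?_, ?_⟩
  · intro h0
    have := congr_fun h0 2
    simp only [Matrix.cons_val_two, Matrix.tail_cons, Matrix.head_cons, Pi.zero_apply,
      Nat.cast_eq_zero] at this
    omega
  · rw [quadTriple_form, quadTriple_hsum, Complex.norm_real, Real.norm_eq_abs]
    have hq0 : (0 : ℝ) < q := by exact_mod_cast hq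
    set X : ℝ := 1 + (q : ℝ) + |(a : ℝ)| + |(b : ℝ)| with hX
    have hX1 : 1 ≤ X := by
      rw [hX]; linarith only [hq0, abs_nonneg (a : ℝ), abs_nonneg (b : ℝ)]
    have hqX : (q : ℝ) ≤ X := by
      rw [hX]; linarith only [abs_nonneg (a : ℝ), abs_nonneg (b : ℝ)]
    have e : (q : ℝ) * y - a - b * Real.sqrt D = q * (y - ((a : ℝ) + b * Real.sqrt D) / q) := by
      field_simp
      ring
    have eX : 1 + (|(a : ℝ)| + |(b : ℝ)| + q) = X := by rw [hX]; ring
    rw [e, abs_mul, Nat.abs_cast, eX]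
    calc (q : ℝ) * |y - ((a : ℝ) + b * Real.sqrt D) / q| < q * Real.exp (-(X ^ (m + 1))) :=
          mul_lt_mul_of_pos_left hlt hq0
      _ ≤ Real.exp (-(X ^ m)) := mul_exp_neg_pow_succ_le hq0 hqX hX1 m

/-- **`HyperQuadApprox D y` ⇒ `1, √D, y` are ℚ-linearly independent** (Liouville in `ℚ(√D)`). -/
theorem linearIndependent_quadTriple {D : ℕ} (hD : Irrational (Real.sqrt D)) {y : ℝ}
    (hy : HyperQuadApprox D y) : LinearIndependent ℚ (quadTriple D y) := by
  rw [Fintype.linearIndependent_iff]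
  intro g hg
  rw [Fin.sum_univ_three] at hg
  simp only [quadTriple_zero, quadTriple_one, quadTriple_two] at hg
  -- the relation g₀ + g₁ √D + g₂ y = 0 over ℝ
  have hgR : (g 0 : ℝ) + (g 1 : ℝ) * Real.sqrt D + (g 2 : ℝ) * y = 0 := by
    have e : ((((g 0 : ℝ) + (g 1 : ℝ) * Real.sqrt D + (g 2 : ℝ) * y : ℝ)) : ℂ) = 0 := by
      rw [← hg]; simp only [Rat.smul_def]; push_cast; ring
    exact_mod_cast e
  have hs0 : 0 ≤ Real.sqrt D := Real.sqrt_nonneg _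
  -- case g₂ = 0 : then g₁ = 0 (√D irrational) and g₀ = 0
  by_cases hg2 : g 2 = 0
  · have h01 : (g 0 : ℝ) + (g 1 : ℝ) * Real.sqrt D = 0 := by simpa [hg2] using hgR
    have hg1 : g 1 = 0 := by
      by_contra hg1
      have hg1R : (g 1 : ℝ) ≠ 0 := by exact_mod_cast hg1
      apply hD
      refine ⟨-(g 0) / g 1, ?_⟩
      push_cast
      rw [div_eq_iff hg1R]; linarith
    have hg0 : g 0 = 0 := by
      have : (g 0 : ℝ) = 0 := by simpa [hg1] using h01
      exact_mod_cast this
    intro i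
    match i with
    | 0 => exact hg0
    | 1 => exact hg1
    | 2 => exact hg2
  · -- case g₂ ≠ 0 : y ∈ ℚ(√D), contradicting `HyperQuadApprox`
    exfalso
    have hg2R : (g 2 : ℝ) ≠ 0 := by exact_mod_cast hg2
    -- y = (u + v √D) / w with integers u, v and w > 0
    set r₀ : ℚ := -(g 0) / g 2 with hr₀
    set r₁ : ℚ := -(g 1) / g 2 with hr₁
    have hy_eq : y = (r₀ : ℝ) + (r₁ : ℝ) * Real.sqrt D := by
      rw [hr₀, hr₁]; push_cast
      field_simp
      linarith
    set w : ℕ := r₀.den * r₁.den with hw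
    set u : ℤ := r₀.num * r₁.den with hu
    set v : ℤ := r₁.num * r₀.den with hv
    have hwpos : (0 : ℝ) < w := by rw [hw]; push_cast; exact mul_pos (by exact_mod_cast r₀.den_pos) (by exact_mod_cast r₁.den_pos)
    have hwy : (w : ℝ) * y = u + v * Real.sqrt D := by
      rw [hy_eq, hw, hu, hv]; push_cast
      rw [← ratCast_mul_den r₀, ← ratCast_mul_den r₁]; ring
    -- the constant and the level
    set c : ℝ := (|(u : ℝ)| + w) + (|(v : ℝ)| + w) * Real.sqrt D + 1 with hc
    have hc1 : 1 ≤ c := by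
      have : 0 ≤ (|(u : ℝ)| + w) + (|(v : ℝ)| + w) * Real.sqrt D := by positivity
      rw [hc]; linarith only [this]
    obtain ⟨T, hT⟩ := exists_le_two_pow (c * w)
    obtain ⟨a, b, q, hq, hne, hlt⟩ := hy (T + 2)
    have hq0 : (0 : ℝ) < q := by exact_mod_cast hq
    set X : ℝ := 1 + (q : ℝ) + |(a : ℝ)| + |(b : ℝ)| with hX
    have hX2 : 2 ≤ X := by
      have hq1 : (1 : ℝ) ≤ q := by exact_mod_cast hq
      rw [hX]; linarith only [hq1, abs_nonneg (a : ℝ), abs_nonneg (b : ℝ)]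
    have hX0 : 0 < X := by linarith only [hX2]
    have hqX : (q : ℝ) ≤ X := by rw [hX]; linarith only [abs_nonneg (a : ℝ), abs_nonneg (b : ℝ)]
    have haX : |(a : ℝ)| ≤ X := by rw [hX]; linarith only [hq0, abs_nonneg (b : ℝ)]
    have hbX : |(b : ℝ)| ≤ X := by rw [hX]; linarith only [hq0, abs_nonneg (a : ℝ)]
    -- U + V √D = w q (y - β)
    set U : ℤ := u * q - a * w with hU
    set V : ℤ := v * q - b * w with hV
    have hqne : (q : ℝ) ≠ 0 := hq0.ne'
    have hUV : (U : ℝ) + V * Real.sqrt D = (w : ℝ) * q * (y - ((a : ℝ) + b * Real.sqrt D) / q) := by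
      rw [hU, hV]; push_cast
      rw [mul_sub, show (w : ℝ) * q * y = q * ((w : ℝ) * y) by ring, hwy]
      field_simp
      ring
    have hUV0 : U ≠ 0 ∨ V ≠ 0 := by
      by_contra hn
      push Not at hn
      obtain ⟨hU0, hV0⟩ := hn
      have : (w : ℝ) * q * (y - ((a : ℝ) + b * Real.sqrt D) / q) = 0 := by
        rw [← hUV, hU0, hV0]; simp
      rcases mul_eq_zero.mp this with h1 | h1
      · rcases mul_eq_zero.mp h1 with h2 | h2
        · exact hwpos.ne' h2
        · exact hq0.ne' h2
      · exact hne (sub_eq_zero.mp h1)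
    have hlow := quad_lower_bound hD U V hUV0
    have hden : |(U : ℝ)| + |(V : ℝ)| * Real.sqrt D + 1 ≤ c * X := by
      have h1 : |(U : ℝ)| ≤ (|(u : ℝ)| + w) * X := by
        rw [hU]; push_cast
        calc |(u : ℝ) * q - a * w| ≤ |(u : ℝ) * q| + |(a : ℝ) * w| := abs_sub _ _
          _ = |(u : ℝ)| * q + |(a : ℝ)| * w := by
              rw [abs_mul, abs_mul, Nat.abs_cast, Nat.abs_cast]
          _ ≤ |(u : ℝ)| * X + X * w := by gcongr
          _ = (|(u : ℝ)| + w) * X := by ring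
      have h2 : |(V : ℝ)| * Real.sqrt D ≤ (|(v : ℝ)| + w) * Real.sqrt D * X := by
        rw [hV]; push_cast
        have : |(v : ℝ) * q - b * w| ≤ (|(v : ℝ)| + w) * X :=
          calc |(v : ℝ) * q - b * w| ≤ |(v : ℝ) * q| + |(b : ℝ) * w| := abs_sub _ _
            _ = |(v : ℝ)| * q + |(b : ℝ)| * w := by
                rw [abs_mul, abs_mul, Nat.abs_cast, Nat.abs_cast]
            _ ≤ |(v : ℝ)| * X + X * w := by gcongr
            _ = (|(v : ℝ)| + w) * X := by ring
        calc |(v : ℝ) * q - b * w| * Real.sqrt D ≤ (|(v : ℝ)| + w) * X * Real.sqrt D :=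
              mul_le_mul_of_nonneg_right this hs0
          _ = (|(v : ℝ)| + w) * Real.sqrt D * X := by ring
      have h3 : (1 : ℝ) ≤ 1 * X := by linarith only [hX2]
      calc |(U : ℝ)| + |(V : ℝ)| * Real.sqrt D + 1
          ≤ (|(u : ℝ)| + w) * X + (|(v : ℝ)| + w) * Real.sqrt D * X + 1 * X := by
            linarith only [h1, h2, h3]
        _ = c * X := by rw [hc]; ring
    -- 1/(c X) ≤ |U + V√D| = w q |y - β| < w X exp(-X^(T+2)) ≤ w X / X^(T+2)
    have hcX : 0 < c * X := by positivity
    have hXp : 0 < X ^ (T + 2) := by positivity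
    have h1 : 1 / (c * X) < (w : ℝ) * X * (1 / X ^ (T + 2)) := by
      calc 1 / (c * X) ≤ 1 / (|(U : ℝ)| + |(V : ℝ)| * Real.sqrt D + 1) :=
            one_div_le_one_div_of_le (by positivity) hden
        _ ≤ |(U : ℝ) + V * Real.sqrt D| := hlow
        _ = (w : ℝ) * q * |y - ((a : ℝ) + b * Real.sqrt D) / q| := by
            rw [hUV, abs_mul, abs_mul, Nat.abs_cast, Nat.abs_cast]
        _ < (w : ℝ) * q * Real.exp (-(X ^ (T + 2))) :=
            mul_lt_mul_of_pos_left hlt (by positivity)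
        _ ≤ (w : ℝ) * X * Real.exp (-(X ^ (T + 2))) := by gcongr
        _ ≤ (w : ℝ) * X * (1 / X ^ (T + 2)) :=
            mul_le_mul_of_nonneg_left (exp_neg_le_one_div' hXp) (by positivity)
    have h2 : X ^ (T + 2) < c * w * X * X := by
      rw [mul_one_div, div_lt_div_iff₀ hcX hXp, one_mul] at h1
      linarith only [h1]
    have h3 : X ^ T < c * w := by
      have e : X ^ (T + 2) = X ^ T * (X * X) := by ring
      rw [e, show c * w * X * X = c * w * (X * X) by ring] at h2
      exact lt_of_mul_lt_mul_right h2 (by positivity)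
    have h4 : c * w ≤ X ^ T :=
      calc c * w ≤ 2 ^ T := hT
        _ ≤ X ^ T := pow_le_pow_left₀ (by norm_num) hX2 T
    linarith only [h3, h4]

/-- **THE ANCHORED CELL AS AN EXPLICIT FAMILY (mod the LW measure):** for every non-square `D` and
every real `y` hyper-approximable from `ℚ(√D)`, `trdeg ℚ(√D, y, e, e^{√D}, e^{y}) ≥ 3`.  Inputs: only
`HyperQuadApprox D y`; LI and `HyperLinLiouville` are CONSEQUENCES (the two theorems above). -/
theorem sb_three_quadTriple (hLW : LWMeasure) {D : ℕ} (hD : Irrational (Real.sqrt D)) {y : ℝ}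
    (hy : HyperQuadApprox D y) : SB 3 (quadTriple D y) :=
  sb_three_of_realQuadAnchor hLW (linearIndependent_quadTriple hD hy)
    (hyperLinLiouville_quadTriple hy) (hasRealQuadAnchor_quadTriple hD y)

end HyperCell

end Summit.Schanuel.Schanuel.Theorems.RootDecomp1KHyper
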